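import Summits.NavierStokesRegularity.FunctionalMining.StretchingLaminateDag
import HarnessLib

/-!
# K1-Q1 laminates: SOUNDNESS of the DAG-native certificate checker — a passing `Dag.check` /
`Dag.checkChunks` is a `Tree` certificate of the unfolded laminate, hence `r ≤ C_lam` and `r ≤ C⋆`

NS FUNCTIONAL MINING cell (`pub-nsfunc`), prove seat gen 15, 2026-08-21 — **search for candidate a
priori estimates; no regularity claim.** STATIC bookkeeping only: nothing about Navier–Stokes solutions
is asserted anywhere in this file.

ALSO DEFINED HERE (computable, kernel-evaluated): `Dag.runChunks` / **`Dag.checkChunks parts r`** — the programme of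
`StretchingLaminateDag` over a list of data CHUNKS (`parts.flatten` = the node list; each chunk one structural
recursion), the entry point used by the certificates of record.

WHAT IS PROVED (kernel): the loop invariant `Dag.Inv` ("every stored summary below index `k` is
TRUTHFUL: its three statistics are `Tree.stretchFrom/energyFrom/vortSupFrom` of the unfolded sub-laminate
`Dag.treeOf nodes j` from its own state, and that sub-laminate is `valid`") is preserved by `Dag.step`
(`inv_step`: the children's stored states are compared with the pushed states, so the one-step recursion
IS the unfolding of `Tree.stretchFrom` by `Tree.stretchFrom_eq_mul`), by `Dag.run` and by `Dag.runChunks`;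
hence **`Dag.cert_treeOf_of_check`**, **`Dag.cert_treeOf_of_checkChunks`** (`… = true →
(treeOf nodes root).cert r = true`) and the assemblies **`Dag.le_laminateSupConst_of_check(Chunks)`**
(`r ≤ C_lam`, via `le_laminateSupConst_of_cert`) and **`Dag.le_stretchingSupConst_of_check(Chunks)`**
(`r ≤ C⋆`, UNCONDITIONAL via `le_stretchingSupConst_of_cert` + `laminateRealization_holds`). Unit test:
the bank's Thm-1 `board` as a 5-state DAG passes both checkers by `decide +kernel` (`1/2 ≤ C⋆` again).
[ours; bookkeeping + checker soundness. No literature claim.]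
-/

namespace Summit.NavierStokesRegularity.FunctionalMining

namespace Laminate

namespace Dag

/-- Truthfulness of a stored summary: its statistics ARE the tree statistics of the unfolded sub-laminate
from its state, and that sub-laminate is valid. [ours; bookkeeping] -/
structure Good (nodes : List Node) (j : ℕ) (v : Val) : Prop where
  sig_eq : v.sig = (treeOf nodes j).stretchFrom v.G 1
  en_eq : v.en = (treeOf nodes j).energyFrom v.G 1
  vs_eq : v.vs = (treeOf nodes j).vortSupFrom v.G
  valid : (treeOf nodes j).valid = true

/-- The loop invariant: every stored summary below index `k` is truthful. [ours; bookkeeping] -/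
def Inv (nodes : List Node) (st : Store) (k : ℕ) : Prop :=
  ∀ j < k, ∀ v, st.get j = some v → Good nodes j v

/-- What `childVal` guarantees under the invariant. [ours; bookkeeping] -/
theorem childVal_good {nodes : List Node} {st : Store} {i : ℕ} (hinv : Inv nodes st i)
    {Gc : Grad} {c : Child} {v : Val} (h : childVal st i Gc c = some v) :
    v.G = Gc ∧ v.sig = (childTree nodes i c).stretchFrom Gc 1 ∧
      v.en = (childTree nodes i c).energyFrom Gc 1 ∧ v.vs = (childTree nodes i c).vortSupFrom Gc ∧
      (childTree nodes i c).valid = true := by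
  cases c with
  | lf =>
    simp only [childVal, Option.some.injEq] at h
    subst h
    simp [childTree, Tree.stretchFrom, Tree.energyFrom, Tree.vortSupFrom, Tree.valid]
  | nd j =>
    simp only [childVal] at h
    by_cases hji : j < i
    · rw [if_pos hji] at h
      cases hget : st.get j with
      | none => rw [hget] at h; simp at h
      | some w =>
        rw [hget] at h
        simp only at h
        by_cases hG : w.G = Gc
        · rw [if_pos hG] at h
          simp only [Option.some.injEq] at h
          subst h
          have hg := hinv j hji w hget
          refine ⟨hG, ?_, ?_, ?_, ?_⟩ <;> simp only [childTree, if_pos hji]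
          · rw [← hG]; exact hg.sig_eq
          · rw [← hG]; exact hg.en_eq
          · rw [← hG]; exact hg.vs_eq
          · exact hg.valid
        · rw [if_neg hG] at h; simp at h
    · rw [if_neg hji] at h; simp at h

/-- One step preserves the invariant and extends it to the new index. [ours; bookkeeping] -/
theorem inv_step {nodes : List Node} {st st' : Store} {i : ℕ} {nd : Node}
    (hinv : Inv nodes st i) (hnd : nodes[i]? = some nd) (h : step i st nd = some st') :
    Inv nodes st' (i + 1) := by
  unfold step at h
  by_cases hval : 0 < nd.s.lam ∧ nd.s.lam < 1 ∧
      nd.s.c0 * nd.s.n0 + nd.s.c1 * nd.s.n1 + nd.s.c2 * nd.s.n2 = 0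
  · rw [if_pos hval] at h
    cases hp : childVal st i (nd.G.layer (1 - nd.s.lam) nd.s) nd.p with
    | none => rw [hp] at h; simp at h
    | some vp =>
      cases hm : childVal st i (nd.G.layer (-nd.s.lam) nd.s) nd.m with
      | none => rw [hp, hm] at h; simp at h
      | some vm =>
        rw [hp, hm] at h
        simp only [forced, decide_true, Bool.and_self, ↓reduceIte, Store.get_set_succ,
          Option.some.injEq] at h
        subst h
        obtain ⟨hpG, hps, hpe, hpv, hpval⟩ := childVal_good hinv hp
        obtain ⟨hmG, hms, hme, hmv, hmval⟩ := childVal_good hinv hm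
        intro j hj v hv
        rw [Store.get_set_succ] at hv
        by_cases hji : j = i
        · subst hji
          rw [if_pos rfl] at hv
          simp only [Option.some.injEq] at hv
          subst hv
          have hT := treeOf_eq nodes j nd hnd
          refine ⟨?_, ?_, ?_, ?_⟩
          · simp only [combine, hT, Tree.stretchFrom]
            rw [Tree.stretchFrom_eq_mul _ _ (1 * nd.s.lam), Tree.stretchFrom_eq_mul _ _ (1 * (1 - nd.s.lam)),
              ← hps, ← hms]
            ring
          · simp only [combine, hT, Tree.energyFrom]
            rw [Tree.energyFrom_eq_mul _ _ (1 * nd.s.lam), Tree.energyFrom_eq_mul _ _ (1 * (1 - nd.s.lam)),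
              ← hpe, ← hme]
            ring
          · simp only [combine, hT, Tree.vortSupFrom, ← hpv, ← hmv]
          · simp [hT, Tree.valid, hpval, hmval, hval.1, hval.2.1, hval.2.2]
        · rw [if_neg hji] at hv
          exact hinv j (by omega) v hv
  · rw [if_neg hval] at h; simp at h

/-- The run preserves the invariant (the list processed from index `i` must agree with `nodes` there).
[ours; bookkeeping] -/
theorem inv_run {nodes : List Node} : ∀ (l : List Node) (i : ℕ) (st st' : Store),
    (∀ k nd, l[k]? = some nd → nodes[i + k]? = some nd) → Inv nodes st i → run l i st = some st' →
      Inv nodes st' (i + l.length)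
  | [], i, st, st', _, hinv, h => by
    simp only [run, Option.some.injEq] at h
    subst h; simpa using hinv
  | nd :: rest, i, st, st', hl, hinv, h => by
    simp only [run] at h
    cases hs : step i st nd with
    | none => rw [hs] at h; simp at h
    | some st₁ =>
      rw [hs] at h
      simp only at h
      have hnd : nodes[i]? = some nd := by have := hl 0 nd (by simp); simpa using this
      have hinv₁ := inv_step hinv hnd hs
      have hl' : ∀ k nd', rest[k]? = some nd' → nodes[i + 1 + k]? = some nd' := fun k nd' hk => by
        have := hl (k + 1) nd' (by simpa using hk)
        rw [← this]; congr 1; omega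
      have := inv_run rest (i + 1) st₁ st' hl' hinv₁ h
      simpa [Nat.add_assoc, Nat.add_comm 1] using this

/-- Run over a list of CHUNKS of nodes (index of the first node = `i`). Each chunk is one structural
recursion that RETURNS before the next starts, which keeps the kernel's evaluation depth proportional to
the chunk length rather than to the number of states. [ours; bookkeeping] -/
def runChunks : List (List Node) → ℕ → Store → Option Store
  | [], _, st => some st
  | ck :: rest, i, st =>
    match run ck i st with
    | none => none
    | some st' => runChunks rest (i + ck.length) st'

/-- **The DAG certificate checker on chunked data** (`parts.flatten` = the node list, root LAST).
[ours; bookkeeping] -/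
def checkChunks (parts : List (List Node)) (r : ℚ) : Bool :=
  match runChunks parts 0 Store.nil with
  | none => false
  | some st =>
    match st.get (parts.flatten.length - 1) with
    | none => false
    | some v => rootOk v r

/-- The chunked run preserves the invariant. [ours; bookkeeping] -/
theorem inv_runChunks {nodes : List Node} : ∀ (parts : List (List Node)) (i : ℕ) (st st' : Store),
    (∀ k nd, parts.flatten[k]? = some nd → nodes[i + k]? = some nd) → Inv nodes st i →
      runChunks parts i st = some st' → Inv nodes st' (i + parts.flatten.length)
  | [], i, st, st', _, hinv, h => by
    simp only [runChunks, Option.some.injEq] at h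
    subst h; simpa using hinv
  | ck :: rest, i, st, st', hl, hinv, h => by
    simp only [runChunks] at h
    cases hs : run ck i st with
    | none => rw [hs] at h; simp at h
    | some st₁ =>
      rw [hs] at h
      simp only at h
      have hc : ∀ k nd, ck[k]? = some nd → nodes[i + k]? = some nd := fun k nd hk => by
        have hk' : k < ck.length := (List.getElem?_eq_some_iff.mp hk).1
        exact hl k nd (by rw [List.flatten_cons, List.getElem?_append_left hk']; exact hk)
      have hinv₁ := inv_run ck i st st₁ hc hinv hs
      have hl' : ∀ k nd, rest.flatten[k]? = some nd → nodes[i + ck.length + k]? = some nd :=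
        fun k nd hk => by
          have := hl (ck.length + k) nd (by
            rw [List.flatten_cons, List.getElem?_append_right (by omega)]; simpa using hk)
          rw [← this]; congr 1; omega
      have := inv_runChunks rest (i + ck.length) st₁ st' hl' hinv₁ h
      simpa [List.flatten_cons, List.length_append, Nat.add_assoc] using this

/-- **SOUNDNESS: a passing DAG check is a `Tree` certificate of the unfolded laminate.** [ours] -/
theorem cert_treeOf_of_check {nodes : List Node} {r : ℚ} (h : check nodes r = true) :
    (treeOf nodes (nodes.length - 1)).cert r = true := by
  unfold check at h
  cases hrun : run nodes 0 Store.nil with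
  | none => rw [hrun] at h; simp at h
  | some st =>
    rw [hrun] at h
    simp only at h
    cases hget : st.get (nodes.length - 1) with
    | none => rw [hget] at h; simp at h
    | some v =>
      rw [hget] at h
      simp only [rootOk, Bool.and_eq_true, decide_eq_true_eq] at h
      obtain ⟨⟨⟨⟨⟨hG, hr⟩, hσ⟩, hE⟩, hM⟩, hineq⟩ := h
      have hinv0 : Inv nodes Store.nil 0 := fun j hj => absurd hj (Nat.not_lt_zero j)
      have hinv := inv_run (nodes := nodes) nodes 0 Store.nil st (fun k nd hk => by simpa using hk) hinv0 hrun
      have hlen : nodes.length - 1 < 0 + nodes.length := by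
        cases hn : nodes.length with
        | zero =>
          -- an empty DAG cannot pass: `run [] = some nil` and `nil.get _ = none`
          have : nodes = [] := List.length_eq_zero_iff.mp hn
          subst this
          simp [run] at hrun
          subst hrun
          simp [Store.get] at hget
        | succ n => omega
      have hgood := hinv _ hlen v hget
      simp only [Tree.cert, Tree.sigma, Tree.energy, Tree.vortSup, Bool.and_eq_true, decide_eq_true_eq]
      rw [← hG, ← hgood.sig_eq, ← hgood.en_eq, ← hgood.vs_eq]
      exact ⟨⟨⟨⟨⟨hgood.valid, hr⟩, hσ⟩, hE⟩, hM⟩, hineq⟩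

/-- **SOUNDNESS (chunked data): a passing `checkChunks` is a `Tree` certificate of the unfolded laminate.**
[ours] -/
theorem cert_treeOf_of_checkChunks {parts : List (List Node)} {r : ℚ} (h : checkChunks parts r = true) :
    (treeOf parts.flatten (parts.flatten.length - 1)).cert r = true := by
  unfold checkChunks at h
  cases hrun : runChunks parts 0 Store.nil with
  | none => rw [hrun] at h; simp at h
  | some st =>
    rw [hrun] at h
    simp only at h
    cases hget : st.get (parts.flatten.length - 1) with
    | none => rw [hget] at h; simp at h
    | some v =>
      rw [hget] at h
      simp only [rootOk, Bool.and_eq_true, decide_eq_true_eq] at h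
      obtain ⟨⟨⟨⟨⟨hG, hr⟩, hσ⟩, hE⟩, hM⟩, hineq⟩ := h
      have hinv0 : Inv parts.flatten Store.nil 0 := fun j hj => absurd hj (Nat.not_lt_zero j)
      have hinv := inv_runChunks (nodes := parts.flatten) parts 0 Store.nil st
        (fun k nd hk => by simpa using hk) hinv0 hrun
      have hlen : parts.flatten.length - 1 < 0 + parts.flatten.length := by
        cases hn : parts.flatten.length with
        | zero =>
          -- no states at all: the final store is empty, contradiction with `hget`
          exfalso
          have hnil : parts.flatten = [] := List.length_eq_zero_iff.mp hn
          have : ∀ (ps : List (List Node)) (i : ℕ), ps.flatten = [] →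
              runChunks ps i Store.nil = some Store.nil := by
            intro ps
            induction ps with
            | nil => intro i _; rfl
            | cons ck rest ih =>
              intro i hc
              rw [List.flatten_cons, List.append_eq_nil_iff] at hc
              obtain ⟨hc1, hc2⟩ := hc
              subst hc1
              simp only [runChunks, run, List.length_nil, Nat.add_zero]
              exact ih i hc2
          rw [this parts 0 hnil] at hrun
          simp only [Option.some.injEq] at hrun
          subst hrun
          simp [Store.get] at hget
        | succ n => omega
      have hgood := hinv _ hlen v hget
      simp only [Tree.cert, Tree.sigma, Tree.energy, Tree.vortSup, Bool.and_eq_true, decide_eq_true_eq]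
      rw [← hG, ← hgood.sig_eq, ← hgood.en_eq, ← hgood.vs_eq]
      exact ⟨⟨⟨⟨⟨hgood.valid, hr⟩, hσ⟩, hE⟩, hM⟩, hineq⟩

/-- **Chunked check ⇒ `r ≤ C_lam`.** [ours] -/
theorem le_laminateSupConst_of_checkChunks {parts : List (List Node)} {r : ℚ}
    (h : checkChunks parts r = true) : ((r : ℚ) : ℝ) ≤ laminateSupConst :=
  le_laminateSupConst_of_cert _ r (cert_treeOf_of_checkChunks h)

/-- **Chunked check ⇒ `r ≤ C⋆`, UNCONDITIONALLY** (`laminateRealization_holds`). [ours] -/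
theorem le_stretchingSupConst_of_checkChunks {parts : List (List Node)} {r : ℚ}
    (h : checkChunks parts r = true) : ((r : ℚ) : ℝ) ≤ stretchingSupConst (d := Fin 3) :=
  le_stretchingSupConst_of_cert laminateRealization_holds _ r (cert_treeOf_of_checkChunks h)

/-- **A passing DAG check bounds the laminate constant: `r ≤ C_lam`.** [ours] -/
theorem le_laminateSupConst_of_check {nodes : List Node} {r : ℚ} (h : check nodes r = true) :
    ((r : ℚ) : ℝ) ≤ laminateSupConst :=
  le_laminateSupConst_of_cert _ r (cert_treeOf_of_check h)

/-- **A passing DAG check bounds the stretching constant: `r ≤ C⋆`, UNCONDITIONALLY**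
(`laminateRealization_holds`). [ours] -/
theorem le_stretchingSupConst_of_check {nodes : List Node} {r : ℚ} (h : check nodes r = true) :
    ((r : ℚ) : ℝ) ≤ stretchingSupConst (d := Fin 3) :=
  le_stretchingSupConst_of_cert laminateRealization_holds _ r (cert_treeOf_of_check h)

/-! ## 5. Unit test: the bank's Thm-1 board as a DAG -/

/-- The `board` of `StretchingLaminates` (σ = 1/4, E = 1/2, M² = 1) as a 4-node DAG in children-first
order: the two loaded strain cells, then the two crossed-shear nodes, root last. [ours; bookkeeping] -/
def boardDag : List Node :=
  [ -- 0: strain cell `−½diag(1,−1,0)`-type state below root·P·M, loaded along e₀… (state pushed from node 2)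
    ⟨(Grad.zero.layer (1 - 1/2) ⟨1/2, 1/2, (-1/2), 0, 1, 1, 0⟩).layer (-(1/2)) ⟨1/2, (-1/2), (-1/2), 0, 1, (-1), 0⟩,
      ⟨1/2, 0, (-2), 0, 0, 0, 1⟩, .lf, .lf⟩,
    -- 1: the other strain cell (state pushed from node 3)
    ⟨(Grad.zero.layer (-(1/2)) ⟨1/2, 1/2, (-1/2), 0, 1, 1, 0⟩).layer (1 - 1/2) ⟨1/2, (-1/2), (-1/2), 0, 1, (-1), 0⟩,
      ⟨1/2, 2, 0, 0, 0, 0, 1⟩, .lf, .lf⟩,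
    -- 2: `+` child of the root
    ⟨Grad.zero.layer (1 - 1/2) ⟨1/2, 1/2, (-1/2), 0, 1, 1, 0⟩, ⟨1/2, (-1/2), (-1/2), 0, 1, (-1), 0⟩, .lf, .nd 0⟩,
    -- 3: `−` child of the root
    ⟨Grad.zero.layer (-(1/2)) ⟨1/2, 1/2, (-1/2), 0, 1, 1, 0⟩, ⟨1/2, (-1/2), (-1/2), 0, 1, (-1), 0⟩, .nd 1, .lf⟩,
    -- 4: root at `G = 0`
    ⟨Grad.zero, ⟨1/2, 1/2, (-1/2), 0, 1, 1, 0⟩, .nd 2, .nd 3⟩ ]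

/-- The board DAG passes with `r = 1/2` (kernel evaluation of the dynamic programme). [ours; computation] -/
theorem boardDag_check : check boardDag (1 / 2) = true := by
  decide +kernel

/-- The board DAG in two chunks passes the chunked checker. [ours; computation] -/
theorem boardDag_checkChunks : checkChunks [boardDag.take 2, boardDag.drop 2] (1 / 2) = true := by
  decide +kernel

/-- … hence `1/2 ≤ C⋆` once more, now through the DAG checker. [ours] -/
theorem half_le_stretchingSupConst_dag : ((1 / 2 : ℚ) : ℝ) ≤ stretchingSupConst (d := Fin 3) :=
  le_stretchingSupConst_of_check boardDag_check

end Dag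

end Laminate

end Summit.NavierStokesRegularity.FunctionalMining
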